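import Mathlib.Combinatorics.Matroid.Closure

/-!
# PercRepro — S2: THE e-FREE CLAUSE IS HEREDITARY UNDER RESTRICTION (p1, gen 31; a feeder for sub-claim S2, owner p7)

The core clause of the level cells, `hfree : ∀ e ∈ E, ∃ A ⊆ E ∖ {e}, e ∉ cl A ∧ e ∉ cl ((E ∖ {e}) ∖ A)` (the `hcore` of `rls_succ_large`,
SUBCLAIM-S2-p7.md §Statement), passes to every restriction `M ↾ W`: the partition of `E ∖ {e}` restricted to `W ∖ {e}` still has neither part
spanning `e`, because closures are monotone and `(M ↾ W).closure X = M.closure X ∩ W` for `X ⊆ W ⊆ E` (`Matroid.restrict_closure_eq`).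
**`hfree_restrict`**. Consequence (proofs/P1-S2-CORANK6.md §2): every local configuration of the core is itself a core — no `U_{2,4}`, `U_{3,6}`,
`U_{4,8}`, `U_{5,10}` restriction — the hereditary reading behind the flat bounds `f(2) = 3`, `f(3) ≤ 6`, `f(4) ≤ 10` and behind the
configuration searches of the `s₄` chain (P1-S4-PERPOINT.md §9). Axioms: standard.
-/

open scoped Matroid

namespace PercRepro

namespace S2

variable {α : Type}

/-- **The e-free clause is hereditary**: if every element of `M` is free (a partition of `E ∖ {e}` with neither part spanning `e`),
then so is every element of the restriction `M ↾ W`, `W ⊆ E`. -/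
theorem hfree_restrict (M : Matroid α) {W : Set α} (hW : W ⊆ M.E)
    (hfree : ∀ e ∈ M.E, ∃ A ⊆ M.E \ {e}, e ∉ M.closure A ∧ e ∉ M.closure ((M.E \ {e}) \ A)) :
    ∀ e ∈ (M ↾ W).E, ∃ A ⊆ (M ↾ W).E \ {e},
      e ∉ (M ↾ W).closure A ∧ e ∉ (M ↾ W).closure (((M ↾ W).E \ {e}) \ A) := by
  intro e he
  rw [Matroid.restrict_ground_eq] at he
  obtain ⟨A, hA, heA, heA'⟩ := hfree e (hW he)
  refine ⟨A ∩ W, ?_, ?_, ?_⟩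
  · rw [Matroid.restrict_ground_eq]
    intro x hx
    exact ⟨hx.2, (hA hx.1).2⟩
  · rw [Matroid.restrict_closure_eq M Set.inter_subset_right hW]
    intro h
    exact heA (M.closure_subset_closure Set.inter_subset_left h.1)
  · rw [Matroid.restrict_ground_eq, Matroid.restrict_closure_eq M (Set.sdiff_subset.trans Set.sdiff_subset) hW]
    · intro h
      refine heA' (M.closure_subset_closure ?_ h.1)
      intro x hx
      refine ⟨⟨hW hx.1.1, hx.1.2⟩, fun hxA => hx.2 ⟨hxA, hx.1.1⟩⟩

/-- The same with the restriction's ground set unfolded (`(M ↾ W).E = W`): the form the cells' generators can cite directly. -/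
theorem hfree_restrict_of_subset (M : Matroid α) {W : Set α} (hW : W ⊆ M.E)
    (hfree : ∀ e ∈ M.E, ∃ A ⊆ M.E \ {e}, e ∉ M.closure A ∧ e ∉ M.closure ((M.E \ {e}) \ A)) (e : α) (he : e ∈ W) :
    ∃ A ⊆ W \ {e}, e ∉ (M ↾ W).closure A ∧ e ∉ (M ↾ W).closure ((W \ {e}) \ A) := by
  have h := hfree_restrict M hW hfree e (by rw [Matroid.restrict_ground_eq]; exact he)
  rw [Matroid.restrict_ground_eq] at h
  exact h

end S2

end PercRepro
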